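import Summits.ValiantsHypothesis.ValiantsHypothesis.Theorems.BarrierLeverAnchoredDoorHitsLowerPairsSplitCalculus

/-!
# Support item `AnchoredDoorHitsLowerPairs` (stmt-ValiantsHypothesis-22510), line `anchored-peeling`:
# the SYMBOLIC SPLIT IDENTITY, part 2: `det (splitMatrix) ≠ 0 ⇒ symbolicDet ≠ 0`

Helper file (`--supports stmt-ValiantsHypothesis-22510`; cell valiant-natproofs, rung V4, 𝒟-side door (c); prover seat val-np-p1 gen 15;
memo HOME/val-np-p1/g15/STARSTEP-RIGID-MEMO-valnp1-g15.md §2.4 (i)). Closes NO item. Kernel form of the defect-transfer split of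
HOME/val-np-p1/g14/ANCHORED-MEMO-valnp1-g14.md §6.2 in the line's symbolic language.

Fix an `x`-vertex `a`, a `y`-vertex `c` and `D ∌ c`. Under the split specialisation of part 1 (`splitHom`: `θ_{({a}|{c})} ↦ 1`,
`θ_{({a}|{d})}` kept for `d ∈ D`, every other anchor meeting `a` or `c` and every twist on `x_a, y_c` killed) the symbolic witness becomes
`(1 + x_a (y_c + Σ_{d ∈ D} θ_{(a|d)} y_d) + x_a² J) · splitRest` (`map_splitHom_symbolicWitness`) with `splitRest` free of `x_a, y_c` and
equal to the full witness on monomials avoiding them (`coeff_splitRest`). Hence (`coeff_map_splitHom`) the specialised layout matrix IS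
`splitMatrix s h r u w a c D`:
rows `a ∉ u i`: `[c ∉ w j] · L[u i, w j]`; rows `a ∈ u i`: `[c ∈ w j] · L[u i ∖ a, w j ∖ c] + [c ∉ w j] · Σ_{d ∈ D ∩ w j} θ_{(a|d)} · L[u i ∖ a, w j ∖ d]`
(`L` = full symbolic layout) — the block matrix `[[X, 0], [Q, Y]]` of the memo — and `symbolicDet_ne_zero_of_splitMatrix`:
`det (splitMatrix) ≠ 0 ⇒ symbolicDet s h r u w ≠ 0` (`s ≥ 1`). With equal stars this is the star(1) step; with `|lk_a R| > |lk_c C|` the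
non-vanishing of `det splitMatrix` is exactly the defect-transfer condition, now one polynomial statement about smaller symbolic layouts
and the fresh parameters `θ_{(a|d)}` — the entry point for a relative-Lefschetz attack on `stub_rigidPairs`.

WHAT THIS IS NOT: an identity, not a step theorem — nothing here proves `det splitMatrix ≠ 0` for any pair; nothing on items 22510 /
19717 themselves, on crux stmt-ValiantsHypothesis-14610, or on `VP` versus `VNP`.
-/

set_option linter.dupNamespace false

namespace Summit.ValiantsHypothesis.ValiantsHypothesis.Theorems.BarrierLever.AnchoredPeeling

open Finset MvPolynomial
open Summit.ValiantsHypothesis.ValiantsHypothesis.Theorems.BarrierLever.BrickCalculus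
  (pexpo pexpo_def pexpo_le_iff pexpo_sub pexpo_apply_castAdd pexpo_apply_natAdd)

noncomputable section

variable {h : ℕ}

/-! ## 3. The split identity -/

section Identity

variable (s : ℕ) (a c : Fin h) (D : Finset (Fin h))

/-- The part of the specialised witness coming from anchors NOT meeting `a`, `c`. -/
def splitRest (s h : ℕ) (a c : Fin h) (D : Finset (Fin h)) : MvPolynomial (Fin (h + h)) (MvPolynomial (Param h) ℂ) :=
  ∏ α ∈ (anchors s h).filter (fun α => ¬ (a ∈ α.1 ∨ c ∈ α.2)), MvPolynomial.map (splitHom a c D) (symbFactor h α)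

/-- `splitRest` avoids `x_a, y_c`. -/
theorem avoids_splitRest : Avoids a c (splitRest s h a c D) := by
  classical
  refine Avoids.prod _ (fun α hα => ?_)
  have hα' := (Finset.mem_filter.mp hα).2
  exact avoids_map_splitHom_symbFactor a c D (fun h' => hα' (Or.inl h')) (fun h' => hα' (Or.inr h'))

/-- `splitRest` agrees with the full symbolic witness off `x_a, y_c`. -/
theorem agreeOff_splitRest : AgreeOff a c (splitRest s h a c D) (symbolicWitness s h) := by
  classical
  rw [symbolicWitness_eq_prod, ← Finset.prod_filter_mul_prod_filter_not (anchors s h) (fun α => a ∈ α.1 ∨ c ∈ α.2),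
    splitRest, ← one_mul (∏ α ∈ (anchors s h).filter (fun α => ¬ (a ∈ α.1 ∨ c ∈ α.2)), _)]
  refine AgreeOff.mul ?_ (AgreeOff.prod _ (fun α hα => ?_))
  · rw [← Finset.prod_const_one (s := (anchors s h).filter (fun α => a ∈ α.1 ∨ c ∈ α.2))]
    refine AgreeOff.prod _ (fun α hα => ?_)
    rw [symbFactor_eq]
    exact agreeOff_one_symbFactor a c (Finset.mem_filter.mp hα).2 _
  · have hα' := (Finset.mem_filter.mp hα).2
    exact agreeOff_map_splitHom_symbFactor a c D (fun h' => hα' (Or.inl h')) (fun h' => hα' (Or.inr h'))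

/-- Coefficients of `splitRest`: the full layout off `x_a, y_c`, zero on it. -/
theorem coeff_splitRest (S T : Finset (Fin h)) :
    coeff (pexpo S T) (splitRest s h a c D) =
      if a ∉ S ∧ c ∉ T then coeff (pexpo S T) (symbolicWitness s h) else 0 := by
  classical
  split_ifs with hST
  · exact agreeOff_splitRest s a c D (pexpo S T) (by rw [pexpo_apply_castAdd, if_neg hST.1])
      (by rw [pexpo_apply_natAdd, if_neg hST.2])
  · refine avoids_splitRest s a c D (pexpo S T) ?_
    rw [not_and_or, not_not, not_not] at hST
    rcases hST with h' | h'
    · left; rw [pexpo_apply_castAdd, if_pos h']; exact one_ne_zero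
    · right; rw [pexpo_apply_natAdd, if_pos h']; exact one_ne_zero

/-- The specialised witness: `(1 + x_a Q + x_a² J) · splitRest` with `Q = y_c + Σ_{d ∈ D} θ_{(a|d)} y_d`. -/
theorem map_splitHom_symbolicWitness (hs : 1 ≤ s) (hcD : c ∉ D) :
    ∃ J : MvPolynomial (Fin (h + h)) (MvPolynomial (Param h) ℂ),
      MvPolynomial.map (splitHom a c D) (symbolicWitness s h) =
        (1 + X (Fin.castAdd h a) * (X (Fin.natAdd h c) + ∑ d ∈ D, C (X (Sum.inl (({a}, {d}) : Finset (Fin h) × Finset (Fin h))))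
            * X (Fin.natAdd h d)) + X (Fin.castAdd h a) ^ 2 * J) * splitRest s h a c D := by
  classical
  obtain ⟨J, hJ⟩ := prod_one_add_X_mul ((anchors s h).filter (fun α => a ∈ α.1 ∨ c ∈ α.2)) (Fin.castAdd h a)
    (splitLin a c D)
  refine ⟨J, ?_⟩
  rw [symbolicWitness_eq_prod, map_prod, ← Finset.prod_filter_mul_prod_filter_not (anchors s h) (fun α => a ∈ α.1 ∨ c ∈ α.2),
    splitRest]
  congr 1
  rw [Finset.prod_congr rfl (fun α hα => map_splitHom_symbFactor_of_meet a c D hcD (Finset.mem_filter.mp hα).2), hJ]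
  congr 3
  -- the linear parts sum to `y_c + Σ θ_{(a|d)} y_d`
  have hmem : ∀ d : Fin h, (({a}, {d}) : Finset (Fin h) × Finset (Fin h)) ∈
      (anchors s h).filter (fun α => a ∈ α.1 ∨ c ∈ α.2) := fun d => by
    rw [Finset.mem_filter]
    refine ⟨?_, Or.inl (Finset.mem_singleton_self a)⟩
    simp only [anchors, Finset.mem_filter, Finset.mem_univ, true_and, Finset.card_singleton]
    exact ⟨le_refl 1, hs, le_refl 1, hs⟩
  simp only [splitLin, Finset.sum_add_distrib]
  rw [Finset.sum_ite_eq' _ (({a}, {c}) : Finset (Fin h) × Finset (Fin h)), if_pos (hmem c), Finset.sum_comm]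
  congr 1
  refine Finset.sum_congr rfl (fun d _ => ?_)
  rw [Finset.sum_ite_eq', if_pos (hmem d)]

/-- `[x^S y^T] (x_a y_e G) = [a ∈ S][e ∈ T] · [x^{S∖a} y^{T∖e}] G`. -/
theorem coeff_pexpo_X_X_mul {R : Type*} [CommSemiring R] (S T : Finset (Fin h)) (e : Fin h)
    (G : MvPolynomial (Fin (h + h)) R) :
    coeff (pexpo S T) (X (Fin.castAdd h a) * X (Fin.natAdd h e) * G) =
      if a ∈ S ∧ e ∈ T then coeff (pexpo (S \ {a}) (T \ {e})) G else 0 := by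
  classical
  have hm : (X (Fin.castAdd h a) * X (Fin.natAdd h e) : MvPolynomial (Fin (h + h)) R) = monomial (pexpo {a} {e}) 1 := by
    rw [pexpo_def, Finset.sum_singleton, Finset.sum_singleton, X, X, monomial_mul, mul_one]
  rw [hm, coeff_monomial_mul', one_mul]
  by_cases hle : a ∈ S ∧ e ∈ T
  · rw [if_pos ((pexpo_le_iff _ _ _ _).mpr ⟨Finset.singleton_subset_iff.mpr hle.1, Finset.singleton_subset_iff.mpr hle.2⟩),
      if_pos hle, pexpo_sub _ _ _ _ (Finset.singleton_subset_iff.mpr hle.1) (Finset.singleton_subset_iff.mpr hle.2)]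
  · rw [if_neg (fun h' => hle ⟨Finset.singleton_subset_iff.mp ((pexpo_le_iff _ _ _ _).mp h').1,
      Finset.singleton_subset_iff.mp ((pexpo_le_iff _ _ _ _).mp h').2⟩), if_neg hle]

/-- The SPLIT MATRIX at `(a, c, D)`: rows `a ∉ S`: the full layout on columns `c ∉ T`, zero on columns `c ∈ T`; rows `a ∈ S`: on columns
`c ∈ T` the link entry `L[S∖a, T∖c]`, on columns `c ∉ T` the transfer `Σ_{d ∈ D ∩ T} θ_{(a|d)} · L[S∖a, T∖d]`. -/
def splitMatrix (s h r : ℕ) (u w : Fin r → Finset (Fin h)) (a c : Fin h) (D : Finset (Fin h)) :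
    Matrix (Fin r) (Fin r) (MvPolynomial (Param h) ℂ) :=
  Matrix.of fun i j =>
    if a ∉ u i then (if c ∉ w j then coeff (pexpo (u i) (w j)) (symbolicWitness s h) else 0)
    else if c ∈ w j then coeff (pexpo (u i \ {a}) (w j \ {c})) (symbolicWitness s h)
    else ∑ d ∈ D, if d ∈ w j then X (Sum.inl (({a}, {d}) : Finset (Fin h) × Finset (Fin h))) *
      coeff (pexpo (u i \ {a}) (w j \ {d})) (symbolicWitness s h) else 0

/-- **Entries of the split specialisation = the split matrix.** -/
theorem coeff_map_splitHom (hs : 1 ≤ s) (hcD : c ∉ D) {r : ℕ} (u w : Fin r → Finset (Fin h)) (i j : Fin r) :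
    coeff (pexpo (u i) (w j)) (MvPolynomial.map (splitHom a c D) (symbolicWitness s h)) = splitMatrix s h r u w a c D i j := by
  classical
  obtain ⟨J, hJ⟩ := map_splitHom_symbolicWitness s a c D hs hcD
  have e1 : (1 + X (Fin.castAdd h a) * (X (Fin.natAdd h c) + ∑ d ∈ D, C (X (Sum.inl (({a}, {d}) : Finset (Fin h) × Finset (Fin h))))
        * X (Fin.natAdd h d)) + X (Fin.castAdd h a) ^ 2 * J) * splitRest s h a c D =
      splitRest s h a c D + X (Fin.castAdd h a) * X (Fin.natAdd h c) * splitRest s h a c D +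
        (∑ d ∈ D, C (X (Sum.inl (({a}, {d}) : Finset (Fin h) × Finset (Fin h)))) *
          (X (Fin.castAdd h a) * X (Fin.natAdd h d) * splitRest s h a c D)) +
        X (Fin.castAdd h a) ^ 2 * (J * splitRest s h a c D) := by
    have hsum : X (Fin.castAdd h a) * (∑ d ∈ D, C (X (Sum.inl (({a}, {d}) : Finset (Fin h) × Finset (Fin h)))) *
        X (Fin.natAdd h d)) * splitRest s h a c D =
        ∑ d ∈ D, C (X (Sum.inl (({a}, {d}) : Finset (Fin h) × Finset (Fin h)))) *
          (X (Fin.castAdd h a) * X (Fin.natAdd h d) * splitRest s h a c D) := by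
      rw [Finset.mul_sum, Finset.sum_mul]
      exact Finset.sum_congr rfl (fun d _ => by ring)
    rw [← hsum]
    ring
  have hterm : ∀ d ∈ D, coeff (pexpo (u i) (w j)) (C (X (Sum.inl (({a}, {d}) : Finset (Fin h) × Finset (Fin h)))) *
      (X (Fin.castAdd h a) * X (Fin.natAdd h d) * splitRest s h a c D)) =
      if a ∈ u i ∧ d ∈ w j ∧ c ∉ w j then X (Sum.inl (({a}, {d}) : Finset (Fin h) × Finset (Fin h))) *
        coeff (pexpo (u i \ {a}) (w j \ {d})) (symbolicWitness s h) else 0 := by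
    intro d hd
    rw [coeff_C_mul, coeff_pexpo_X_X_mul]
    have hdc : d ≠ c := fun h' => hcD (h' ▸ hd)
    by_cases h1 : a ∈ u i ∧ d ∈ w j
    · rw [if_pos h1, coeff_splitRest]
      have hna : a ∉ u i \ {a} := fun h' => (Finset.mem_sdiff.mp h').2 (Finset.mem_singleton_self a)
      by_cases h2 : c ∈ w j
      · rw [if_neg (fun h' => h'.2 (Finset.mem_sdiff.mpr ⟨h2, fun h'' => hdc.symm (Finset.mem_singleton.mp h'')⟩)),
          if_neg (fun h' => h'.2.2 h2), mul_zero]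
      · rw [if_pos ⟨hna, fun h' => h2 (Finset.mem_sdiff.mp h').1⟩, if_pos ⟨h1.1, h1.2, h2⟩]
    · rw [if_neg h1, if_neg (fun h' => h1 ⟨h'.1, h'.2.1⟩), mul_zero]
  rw [hJ, e1, coeff_add, coeff_add, coeff_add, coeff_pexpo_X_sq_mul, add_zero, coeff_pexpo_X_X_mul,
    coeff_splitRest s a c D (u i) (w j), coeff_splitRest s a c D (u i \ {a}) (w j \ {c}), coeff_sum,
    Finset.sum_congr rfl hterm, splitMatrix, Matrix.of_apply]
  have hna : a ∉ u i \ {a} := fun h' => (Finset.mem_sdiff.mp h').2 (Finset.mem_singleton_self a)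
  have hnc : c ∉ w j \ {c} := fun h' => (Finset.mem_sdiff.mp h').2 (Finset.mem_singleton_self c)
  by_cases hai : a ∈ u i <;> by_cases hcj : c ∈ w j <;> simp [hai, hcj, hna, hnc]

/-- **The split identity.** `det (splitMatrix) ≠ 0 ⇒ symbolicDet ≠ 0` (profile bound `s ≥ 1`, `c ∉ D`). -/
theorem symbolicDet_ne_zero_of_splitMatrix (s h r : ℕ) (u w : Fin r → Finset (Fin h)) (a c : Fin h) (D : Finset (Fin h))
    (hs : 1 ≤ s) (hcD : c ∉ D) (hM : (splitMatrix s h r u w a c D).det ≠ 0) : symbolicDet s h r u w ≠ 0 := by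
  intro hzero
  apply hM
  have h1 : symbolicDet s h r u w =
      (Matrix.of fun i j : Fin r => coeff (pexpo (u i) (w j)) (symbolicWitness s h)).det := rfl
  have h2 : splitMatrix s h r u w a c D =
      (splitHom a c D).mapMatrix (Matrix.of fun i j : Fin r => coeff (pexpo (u i) (w j)) (symbolicWitness s h)) := by
    ext i j
    rw [RingHom.mapMatrix_apply, Matrix.map_apply, Matrix.of_apply, ← coeff_map, coeff_map_splitHom s a c D hs hcD]
  rw [h2, ← RingHom.map_det, ← h1, hzero, map_zero]

end Identity
end

end Summit.ValiantsHypothesis.ValiantsHypothesis.Theorems.BarrierLever.AnchoredPeeling
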